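import Literature.Barriers.QuantumAdvantage.Relativization
import Literature.Computability.QuantumComplexity.OracleSeparationsProofs
import HarnessLib

/-!
# Barrier `Relativization` (`QuantumAdvantage` catalogue): the entry fact with the discharged oracle facts fed in

Sibling proof file (D-0014 append protocol; theorems only) of the D-0021 barrier entry
`Literature/Barriers/QuantumAdvantage/Relativization.lean`. The entry fact

`Relativization : ∃ A B, BQP^A ⊆ BPP^A ∧ ¬ BQP^B ⊆ BPP^B`

(tree model: `BQPRel` = polynomial-time uniform Clifford+T families with XOR-query gates to a
language, `BPPRel (Oracle.ofLanguage ·)`) is assembled in the entry file from the two oracle facts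
of `QuantumComplexity/OracleSeparations.lean` (`Relativization.of_facts`), and the entry stays light
on imports. Both facts are theorems of the tree (`QuantumComplexity/OracleSeparationsProofs.lean`):
`exists_oracle_BQPRel_subset_BPPRel_holds` (the collapsing oracle; Ko's self-encoding oracle of
`BQPCollapsingOracle.lean`, printed as the `PSPACE`-complete oracle, Bernstein–Vazirani 1997 Thm. 8.4
with Baker–Gill–Solovay / Fortnow–Rogers 1999 Thm. 4.2) and
`exists_oracle_BQPRel_not_subset_BPPRel_holds` (the separating oracle, Bernstein–Vazirani 1997
Thm. 8.10 / Cor. 8.14; proved in the tree through the Raz–Tal Forrelation oracle, App. A of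
Raz–Tal 2022). This file records the unconditional consequences: `Relativization_holds` and the
hypothesis-free forms of the entry's no-go readings (`Relativization.summary'`,
`Relativization.summary_bqpRelOf'`, `Relativization.not_relativizes_either'`).

## References

* E. Bernstein, U. Vazirani, *Quantum complexity theory*, SIAM J. Comput. 26 (1997) 1411–1473
  [BernsteinVazirani1997SICOMP], Thm. 8.4, Thm. 8.10, Cor. 8.14, §8.4.
* R. Raz, A. Tal, *Oracle separation of BQP and PH*, J. ACM 69 (2022) [RazTalJACM2022], Cor. 1.5
  and App. A.
* L. Fortnow, J. Rogers, *Complexity limitations on quantum computation*, JCSS 59 (1999)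
  [FortnowRogers1999JCSS], Thm. 4.2.
* S. Arora, B. Barak, *Computational Complexity* (2009) [AroraBarakCC2009], §3.4 and Thm. 3.7
  (relativizing proofs; Baker–Gill–Solovay).
-/

noncomputable section

namespace Literature.Barriers.QuantumAdvantage

open _root_.Computability Literature.Computability.Complexity Literature.Computability.Complexity.Classes Literature.Computability.Cryptography Literature.Computability.QuantumComplexity PneNP

/-- **The relativization barrier for `BQP` versus `BPP`, unconditional**: there are oracles `A`, `B`
with `BQP^A ⊆ BPP^A` and `BQP^B ⊄ BPP^B` — the catalogue fact `Relativization` holds, both oracle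
facts being discharged in the tree. [cite: BernsteinVazirani1997SICOMP, Thm. 8.10 and Cor. 8.14 (separating oracle), Thm. 8.4 (collapsing oracle)] [cite: RazTalJACM2022, Cor. 1.5 (App. A)] -/
theorem Relativization_holds : Relativization :=
  Relativization.of_facts exists_oracle_BQPRel_subset_BPPRel_holds
    exists_oracle_BQPRel_not_subset_BPPRel_holds

/-- **No relativizing proof of the summit or of its negation, for any presentation of `BQP^·`**,
hypothesis-free form of the entry's `Relativization.summary`: for every oracle-indexed class `C`
agreeing with `BQPRel` on language oracles, neither `O ↦ ∃ L ∈ C O, L ∉ BPP^O` (the summit's shape)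
nor `O ↦ C O ⊆ BPP^O` (route `Dequantize`'s thesis shape) holds relative to every oracle.
[cite: BernsteinVazirani1997SICOMP, §8.4 with Thm. 8.4, Thm. 8.10 and Cor. 8.14] [cite: AroraBarakCC2009, Thm. 3.7 and p. 74] -/
theorem Relativization.summary' {C : Oracle → Set (Language Bool)} (hC : PresentsBQPRel C) :
    (¬ Relativizes fun O => ∃ L ∈ C O, L ∉ BPPRel O) ∧
      ¬ Relativizes fun O => C O ⊆ BPPRel O :=
  Relativization_holds.summary hC

/-- The same for the canonical presentation `bqpRelOf` — no hypothesis left at all.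
[cite: BernsteinVazirani1997SICOMP, §8.4] [cite: AroraBarakCC2009, Thm. 3.7 and p. 74] -/
theorem Relativization.summary_bqpRelOf' :
    (¬ Relativizes fun O => ∃ L ∈ bqpRelOf O, L ∉ BPPRel O) ∧
      ¬ Relativizes fun O => bqpRelOf O ⊆ BPPRel O :=
  Relativization_holds.summary_bqpRelOf

/-- Baker–Gill–Solovay verbatim for `Φ O := BQP^O ⊆ BPP^O` (canonical presentation): neither `Φ`
nor `¬ Φ` relativizes, hypothesis-free. [cite: ImpagliazzoKabanetsKolokolova2009, §1] [cite: AroraBarakCC2009, Thm. 3.7] -/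
theorem Relativization.not_relativizes_either' :
    (¬ Relativizes fun O => bqpRelOf O ⊆ BPPRel O) ∧ ¬ Relativizes fun O => ¬ bqpRelOf O ⊆ BPPRel O :=
  Relativization_holds.not_relativizes_either presentsBQPRel_bqpRelOf

end Literature.Barriers.QuantumAdvantage

end
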